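import Summits.CriticalPhenomena.Ising3D.Control2DIndexL15
import HarnessLib

/-!
# The Λ = 17 index list of the 2D γ-certificates
(cell `pub-ising3x`, seat controls-1 gen 22; KERNEL PATH for the 2D γ-certificates, Λ = 17 — CONTROL-ONLY scaffolding)

HONEST FRAMING: lottery ticket; floor = tightest certified 3D Ising CFT bounds; no exact-solution
claim without a proof. Nothing about any CFT is asserted here.

The Λ = 17 derivative functional of the cell (the P9(a) object: kit `j195171`, E₀ = 40, box `[0.977, 0.982]` at
`Δσ = 1/8`, format `deriv-functional-2d/2`, functional sha256 `960ca02c…`) is a table on the 45 pairs `(m, n)` with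
`m > n`, `m + n` odd `≤ 17` (the certificate's `index_set`, in its order): `slL15` followed by the nine pairs with
`m + n = 17`. Shared by the Λ = 17 table / cells / assembly files of its kernel replay (`Control2DL17BoxY*`).
-/

namespace Summit.CriticalPhenomena.Ising3D.Control2D

/-- The Λ = 17 index list: the 45 pairs `(m, n)`, `m > n`, `m + n` odd `≤ 17`. [folklore] -/
def slL17 : List (ℕ × ℕ) := [(1, 0), (3, 0), (2, 1), (5, 0), (4, 1), (3, 2), (7, 0), (6, 1), (5, 2), (4, 3),
  (9, 0), (8, 1), (7, 2), (6, 3), (5, 4), (11, 0), (10, 1), (9, 2), (8, 3), (7, 4), (6, 5),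
  (13, 0), (12, 1), (11, 2), (10, 3), (9, 4), (8, 5), (7, 6),
  (15, 0), (14, 1), (13, 2), (12, 3), (11, 4), (10, 5), (9, 6), (8, 7),
  (17, 0), (16, 1), (15, 2), (14, 3), (13, 4), (12, 5), (11, 6), (10, 7), (9, 8)]

/-- [folklore] -/
theorem slL17_nodup : slL17.Nodup := by decide

/-- [folklore] -/
theorem slL17_deg : ∀ p ∈ slL17, p.1 + p.2 ≤ 17 := by decide

/-- `slL17` extends `slL15`. [folklore] -/
theorem slL17_eq_append :
    slL17 = slL15 ++ [(17, 0), (16, 1), (15, 2), (14, 3), (13, 4), (12, 5), (11, 6), (10, 7), (9, 8)] := rfl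

end Summit.CriticalPhenomena.Ising3D.Control2D
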